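import Summits.ABC.StewartYu.PadicG3SchedS
import Summits.ABC.StewartYu.PadicG3Lambda
import HarnessLib

/-!
# Cell abc-stewartyu, crux `Y07Odd` (stmt-ABC-19658), line `gen3-slab-odd`: the record's supply `RecordSupplyAt'` BUILT FROM NAMED CLOSED-FORM
# INEQUALITIES over an ABSTRACT SCHEDULE `D : G3Sched n` (generic twin of `PadicG3RecordG`; specialise with `PadicG3SchedInst`)

`Summits/ABC/StewartYu/PadicG3RecordS.lean` — cell `abc-stewartyu` (seat p2-g4, F-odd lead).  Definitions (`XbSS`, `AmaxS`, `PmaxS`) and ONE theorem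
**`recordSupplyAt'_of_ineqS`** — verbatim `recordSupplyAt'_of_ineqG` with the schedule read from `Sc` (`m := Sc.m`, box `sideS`, `Sc.L₀`, `Sc.H`,
`Sc.Sd`, nodes `NS`/`NhS`, jets `tS`, orders `TordS`); no named fact.

References: Yu. V. Nesterenko, LNM 1819 (2003) Prop. 4.1, §5.
-/

noncomputable section

open NormedSpace Finset Polynomial
open Literature.NumberTheory.Transcendental
open Literature.NumberTheory.Transcendental.PadicCW77 (condExp)
open Literature.NumberTheory.Transcendental.CW77.Setup (Tau tauNorm)
open Summit.ABC.StewartYu.GenThreeFrameSpecOdd (RecordOdd)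
open scoped Nat

namespace Summit.ABC.StewartYu

namespace G3Setup

variable {p : ℕ} [Fact p.Prime] (S : G3Setup p) (Sc : G3Sched S.n)

/-- The directional bound of the START (`≥ 1`): `max 1 (XbC (Lb side 0))`. [folklore] -/
def XbSS : ℤ := max 1 (S.XbC (S.Lb (S.sideS Sc) 0))

/-- The Siegel entry bound of the START: `M0C(L₀G, HG, ŜG, 0, X₀, T₀) · XbS^{T₀} · monDen(α, 2·side·X₀)²` with `X₀ = NG 0 0`, `T₀ = TordG 0 0`. [folklore] -/
def AmaxS : ℝ :=
  (M0C Sc.L₀ Sc.H Sc.Sd 0 (S.NS Sc 0 0 : ℤ) (S.TordS Sc 0 0) : ℝ) * (S.XbSS Sc : ℝ) ^ (S.TordS Sc 0 0) *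
    ((MonomialDen.monDen S.α (S.boxExpG (S.Lb (S.sideS Sc) 0) (S.NS Sc 0 0 : ℤ)) : ℝ)) ^ 2

/-- The coefficient bound of Siegel's lemma, uniform in the class: `⌈UcardC · AmaxC⌉`. [folklore] -/
def PmaxS : ℤ := ⌈(S.UcardS Sc : ℝ) * S.AmaxS Sc⌉

/-- `1 ≤ AmaxC`. [folklore] -/
theorem one_le_AmaxS : (1 : ℝ) ≤ S.AmaxS Sc := by
  unfold AmaxS
  have hM : (1 : ℝ) ≤ (M0C Sc.L₀ Sc.H Sc.Sd 0 (S.NS Sc 0 0 : ℤ) (S.TordS Sc 0 0) : ℝ) := by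
    have h1 : (1 : ℤ) ≤ M0C Sc.L₀ Sc.H Sc.Sd 0 (S.NS Sc 0 0 : ℤ) (S.TordS Sc 0 0) := by
      unfold M0C
      refine Int.one_le_ceil_iff.mpr ?_
      have hb : (1 : ℝ) ≤ Real.exp 1 * (1 + |((2 ^ (Sc.Sd - 0) * (S.NS Sc 0 0 : ℤ) : ℤ) : ℝ)| / Sc.H) := by
        have : (1 : ℝ) ≤ Real.exp 1 := Real.one_le_exp zero_le_one
        have : (0 : ℝ) ≤ |((2 ^ (Sc.Sd - 0) * (S.NS Sc 0 0 : ℤ) : ℤ) : ℝ)| / Sc.H := by positivity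
        nlinarith
      have h2 : (1 : ℝ) ≤ (2 : ℝ) ^ ((Sc.Sd - 0) * S.TordS Sc 0 0) := one_le_pow₀ (by norm_num)
      have h3 : (1 : ℝ) ≤ (Nat.lcmUpto Sc.H : ℝ) ^ S.TordS Sc 0 0 := one_le_pow₀ (by exact_mod_cast Nat.lcmUpto_pos Sc.H)
      have h4 : (1 : ℝ) ≤ Real.exp (Sc.H / Real.exp 1) := Real.one_le_exp (by positivity)
      have h5 : (1 : ℝ) ≤ (Real.exp 1 * (1 + |((2 ^ (Sc.Sd - 0) * (S.NS Sc 0 0 : ℤ) : ℤ) : ℝ)| / Sc.H)) ^ Sc.L₀ := one_le_pow₀ hb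
      have h6 := one_le_mul_of_one_le_of_one_le h2 (one_le_mul_of_one_le_of_one_le h3 (one_le_mul_of_one_le_of_one_le h4 h5))
      linarith
    exact_mod_cast h1
  have hX : (1 : ℝ) ≤ (S.XbSS Sc : ℝ) := by unfold XbSS; exact_mod_cast le_max_left _ _
  have hm : (1 : ℝ) ≤ (MonomialDen.monDen S.α (S.boxExpG (S.Lb (S.sideS Sc) 0) (S.NS Sc 0 0 : ℤ)) : ℝ) := by
    exact_mod_cast MonomialDen.one_le_monDen _ S.α_ne _
  calc (1 : ℝ) = 1 * 1 * 1 := by ring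
    _ ≤ _ := mul_le_mul (mul_le_mul hM (one_le_pow₀ hX) zero_le_one (by positivity)) (one_le_pow₀ hm) zero_le_one (by positivity)

/-- `0 ≤ PmaxC`. [folklore] -/
theorem PmaxS_nonneg : (0 : ℤ) ≤ S.PmaxS Sc := by
  unfold PmaxS; exact Int.ceil_nonneg (mul_nonneg (Nat.cast_nonneg _) (le_trans zero_le_one (S.one_le_AmaxS Sc)))

/-- **THE RECORD'S SUPPLY FROM NAMED INEQUALITIES.** [cite: Nesterenko2003, Prop 4.1, §5; shape only] -/
theorem recordSupplyAt'_of_ineqS (hn : 1 ≤ S.n) (C : ℕ → ℝ) (V : Fin S.n → ℝ) (Vmax W : ℝ) (X' S₀ D₀ : ℕ) (D : Fin S.n → ℕ)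
    -- the Λ-order line (from the negated bound)
    (hne : ∏ j, S.α j ^ S.b j ≠ 1)
    (hord : ((Sc.m + 1 : ℕ) : ℤ) + padicValInt p (S.b S.j₀) ≤ padicValRat p (∏ j, S.α j ^ S.b j - 1))
    -- (B1) the Siegel count at level 0
    (hB1 : 2 * (Icc (-(S.NS Sc 0 0 : ℤ)) (S.NS Sc 0 0) ×ˢ CW77.Setup.tauSet S.n (S.TordS Sc 0 0)).card * ((p - 1) * p ^ Sc.m) ≤
      (Sc.L₀ + 1) * ∏ j, (2 * S.sideS Sc j + 1))
    -- the k-steps of level 0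
    (hK0 : ∀ ν < S.n, ∀ x₁ : ℤ, |x₁| ≤ (S.NS Sc 0 (ν + 1) : ℤ) → ∀ τ : Tau S.n, tauNorm τ + S.tS Sc 0 ≤ S.TordS Sc 0 ν →
      max (BwC (p := p) Sc.L₀ Sc.H Sc.m * ‖S.Λ / (S.b S.j₀ : ℚ_[p])‖ * (p : ℝ) ^ ((S.tS Sc 0 - 1) / 2) *
            (p : ℝ) ^ condExp p (2 * S.NS Sc 0 ν + 1) (S.tS Sc 0))
        (BwC (p := p) Sc.L₀ Sc.H Sc.m / ((p : ℝ) ^ Sc.m * Real.sqrt p) ^ ((2 * S.NS Sc 0 ν + 1) * S.tS Sc 0)) <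
      1 / S.KC (S.UcardS Sc) (S.PmaxS Sc) Sc.L₀ Sc.H Sc.Sd 0 (S.Lb (S.sideS Sc) 0) x₁ τ)
    -- the Kummer half-steps
    (hH : ∀ lev < Sc.Sd, ∀ s₁ : ℤ, Odd s₁ → |s₁| ≤ (2 * S.NhS Sc (lev + 1) - 1 : ℤ) → ∀ τ : Tau S.n, tauNorm τ + S.tS Sc lev ≤ S.TordS Sc lev S.n →
      max (BwC (p := p) Sc.L₀ Sc.H Sc.m * ‖S.Λ / (S.b S.j₀ : ℚ_[p])‖ * (p : ℝ) ^ ((S.tS Sc lev - 1) / 2) *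
            (p : ℝ) ^ condExp p (2 * S.NS Sc lev S.n + 1) (S.tS Sc lev))
        (BwC (p := p) Sc.L₀ Sc.H Sc.m / ((p : ℝ) ^ Sc.m * Real.sqrt p) ^ ((2 * S.NS Sc lev S.n + 1) * S.tS Sc lev)) <
      (S.DC (S.Lb (S.sideS Sc) lev) Sc.H s₁ τ : ℝ) /
        (4 * (S.DC (S.Lb (S.sideS Sc) lev) Sc.H s₁ τ : ℝ) ^ 2 * (1 + (S.UcardS Sc : ℝ) * (S.PmaxS Sc) * S.MhC (S.Lb (S.sideS Sc) lev) Sc.L₀ Sc.H Sc.Sd lev s₁ τ) *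
          CW77.heightProd S.α ^ 3) ^ (2 ^ (S.n + 1)))
    -- the odd-node k-steps (first step of each level ≥ 1)
    (hO : ∀ lev < Sc.Sd, ∀ x₁ : ℤ, |x₁| ≤ (S.NS Sc (lev + 1) 1 : ℤ) → ∀ τ : Tau S.n, tauNorm τ + S.tS Sc (lev + 1) ≤ S.TordS Sc (lev + 1) 0 →
      max (BwC (p := p) Sc.L₀ Sc.H Sc.m * ‖S.Λ / (S.b S.j₀ : ℚ_[p])‖ * (p : ℝ) ^ ((S.tS Sc (lev + 1) - 1) / 2) *
            (p : ℝ) ^ condExp p (2 * S.NhS Sc (lev + 1)) (S.tS Sc (lev + 1)))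
        (BwC (p := p) Sc.L₀ Sc.H Sc.m / ((p : ℝ) ^ Sc.m * Real.sqrt p) ^ ((2 * S.NhS Sc (lev + 1)) * S.tS Sc (lev + 1))) <
      1 / S.KC (S.UcardS Sc) (S.PmaxS Sc) Sc.L₀ Sc.H Sc.Sd (lev + 1) (S.Lb (S.sideS Sc) (lev + 1)) x₁ τ)
    -- the symmetric k-steps of the levels ≥ 1
    (hK : ∀ lev < Sc.Sd, ∀ ν, 1 ≤ ν → ν < S.n → ∀ x₁ : ℤ, |x₁| ≤ (S.NS Sc (lev + 1) (ν + 1) : ℤ) →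
      ∀ τ : Tau S.n, tauNorm τ + S.tS Sc (lev + 1) ≤ S.TordS Sc (lev + 1) ν →
      max (BwC (p := p) Sc.L₀ Sc.H Sc.m * ‖S.Λ / (S.b S.j₀ : ℚ_[p])‖ * (p : ℝ) ^ ((S.tS Sc (lev + 1) - 1) / 2) *
            (p : ℝ) ^ condExp p (2 * S.NS Sc (lev + 1) ν + 1) (S.tS Sc (lev + 1)))
        (BwC (p := p) Sc.L₀ Sc.H Sc.m / ((p : ℝ) ^ Sc.m * Real.sqrt p) ^ ((2 * S.NS Sc (lev + 1) ν + 1) * S.tS Sc (lev + 1))) <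
      1 / S.KC (S.UcardS Sc) (S.PmaxS Sc) Sc.L₀ Sc.H Sc.Sd (lev + 1) (S.Lb (S.sideS Sc) (lev + 1)) x₁ τ)
    -- the END sizing and the record obligations
    (hXfin : 2 * ((S.n + 1) * X') ≤ S.NS Sc Sc.Sd S.n) (hSfin : (S.n + 1) * S₀ < S.TordS Sc Sc.Sd S.n) (hD₀ : Sc.L₀ ≤ D₀)
    (hD : ∀ j, 2 * S.Lb (S.sideS Sc) Sc.Sd j ≤ D j) (hrec : RecordOdd C p S.n V Vmax W D₀ S₀ X' D) :
    S.RecordSupplyAt' C V Vmax W := by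
  classical
  have hH1 : 1 ≤ Sc.H := Sc.hH
  have hm1 : 1 ≤ Sc.m + 1 := by omega
  -- Λ
  have hΛm : ‖S.Λ / (S.b S.j₀ : ℚ_[p])‖ ≤ (p : ℝ)⁻¹ ^ (Sc.m + 1) := S.norm_Λ_div_le_of_padicValRat hm1 hne hord
  have hΛ : ‖S.Λ / (S.b S.j₀ : ℚ_[p])‖ ≤ (p : ℝ)⁻¹ := by
    refine hΛm.trans ?_
    rw [pow_succ]
    exact mul_le_of_le_one_left (inv_nonneg.mpr S.p_pos.le)
      (pow_le_one₀ (inv_nonneg.mpr S.p_pos.le) (inv_le_one_of_one_le₀ S.one_lt_p.le))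
  -- abbreviations
  set side := S.sideS Sc with hside
  set X₀ : ℕ := S.NS Sc 0 0 with hX₀
  set T₀ : ℕ := S.TordS Sc 0 0 with hT₀
  set E : Finset (ℤ × Tau S.n) := Icc (-(X₀ : ℤ)) X₀ ×ˢ CW77.Setup.tauSet S.n T₀ with hE
  have hT₀1 : 1 ≤ T₀ := by
    rw [hT₀]; unfold TordS remS
    have h1 : 1 ≤ S.n - 0 := by omega
    exact le_trans h1 ((Nat.le_add_left _ _).trans (Nat.le_add_left _ _))
  -- START data (closed forms)
  have hXb := S.hXb_closed (S.Lb side 0)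
  have hXbS : ∀ lam ∈ S.box side, ∀ lam' ∈ S.box side, ∀ k, |S.𝔛 (lam - lam') k| ≤ S.XbSS Sc := by
    intro lam hl lam' hl' k
    refine le_trans (hXb (lam - lam') (fun j => ?_) k) (by unfold XbSS; exact le_max_right _ _)
    have h1 := S.mem_box.mp hl j
    have h2 := S.mem_box.mp hl' j
    simp only [Pi.sub_apply]
    rw [abs_le] at h1 h2 ⊢
    unfold Lb; push_cast; constructor <;> omega
  have hR0 : ∀ e ∈ E, ∀ ℓ₀ ≤ Sc.L₀, ∃ z₀ : ℤ,
      (((Nat.lcmUpto Sc.H) ^ e.2.1 : ℕ) : ℚ) * (hasseDeriv e.2.1 (S.Rl Sc.H Sc.Sd 0 (ℓ₀, 0))).eval (e.1 : ℚ) = z₀ ∧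
        |z₀| ≤ M0C Sc.L₀ Sc.H Sc.Sd 0 e.1 e.2.1 := by
    intro e _ ℓ₀ hℓ₀
    exact S.exists_int_lcm_pow_mul_hasse_Rl hH1 Sc.Sd 0 (ℓ₀, (0 : Fin S.n → ℤ)) e.2.1 e.1
      (S.M0C_spec (p := p) hH1 Sc.L₀ Sc.Sd 0 (ℓ₀, (0 : Fin S.n → ℤ)) hℓ₀ e.1 e.2.1)
  have hA : ∀ e ∈ E, (M0C Sc.L₀ Sc.H Sc.Sd 0 e.1 e.2.1 : ℝ) * (S.XbSS Sc : ℝ) ^ (∑ k, e.2.2 k) *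
      ((MonomialDen.monDen S.α (S.boxExpG (fun j => 2 * side j) e.1) : ℝ)) ^ 2 ≤ S.AmaxS Sc := by
    intro e he
    rw [hE, mem_product, mem_Icc, CW77.Setup.mem_tauSet] at he
    obtain ⟨⟨h1, h2⟩, hτ⟩ := he
    have hxe : |e.1| ≤ |(X₀ : ℤ)| := by rw [abs_le]; rw [Nat.abs_cast]; exact ⟨h1, h2⟩
    have ht0 : e.2.1 ≤ T₀ := by unfold tauNorm at hτ; omega
    have hts : ∑ k, e.2.2 k ≤ T₀ := by unfold tauNorm at hτ; omega
    have hM : (M0C Sc.L₀ Sc.H Sc.Sd 0 e.1 e.2.1 : ℝ) ≤ M0C Sc.L₀ Sc.H Sc.Sd 0 (X₀ : ℤ) T₀ := by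
      exact_mod_cast M0C_mono Sc.L₀ Sc.H Sc.Sd 0 hxe ht0
    have hM0 : (0 : ℝ) ≤ M0C Sc.L₀ Sc.H Sc.Sd 0 e.1 e.2.1 := by
      have : (0 : ℤ) ≤ M0C Sc.L₀ Sc.H Sc.Sd 0 e.1 e.2.1 := by unfold M0C; exact Int.ceil_nonneg (by positivity)
      exact_mod_cast this
    have hX1 : (1 : ℝ) ≤ (S.XbSS Sc : ℝ) := by unfold XbSS; exact_mod_cast le_max_left _ _
    have hXp : (S.XbSS Sc : ℝ) ^ (∑ k, e.2.2 k) ≤ (S.XbSS Sc : ℝ) ^ T₀ := pow_le_pow_right₀ hX1 hts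
    have hmon : (MonomialDen.monDen S.α (S.boxExpG (fun j => 2 * side j) e.1) : ℝ) ≤
        MonomialDen.monDen S.α (S.boxExpG (S.Lb side 0) (X₀ : ℤ)) := by
      exact_mod_cast monDen_boxExpG_mono S (S.Lb side 0) hxe
    unfold AmaxS
    have hm0 : (0 : ℝ) ≤ (MonomialDen.monDen S.α (S.boxExpG (fun j => 2 * side j) e.1) : ℝ) := by positivity
    exact mul_le_mul (mul_le_mul hM hXp (by positivity) (le_trans hM0 hM)) (pow_le_pow_left₀ hm0 hmon 2) (by positivity)
      (mul_nonneg (le_trans hM0 hM) (by positivity))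
  refine ⟨Sc.m, side, Sc.L₀, Sc.H, Sc.Sd, X₀, T₀, S.NS Sc, S.TordS Sc, S.NhS Sc, X', S₀,
    fun e => (Nat.lcmUpto Sc.H) ^ e.2.1, fun e => M0C Sc.L₀ Sc.H Sc.Sd 0 e.1 e.2.1, S.XbSS Sc, S.AmaxS Sc, D₀, D,
    hT₀1, rfl, rfl, hΛ, hΛm, hB1, fun e _ => Nat.one_le_pow _ _ (Nat.lcmUpto_pos _), hR0, hXbS, S.one_le_AmaxS Sc, hA,
    ?_, hXfin, hSfin, hD₀, hD, hrec⟩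
  -- the packages, uniformly in the class
  intro 𝔏 h𝔏
  set P𝔏 : ℤ := ⌈((S.unk Sc.L₀ 𝔏).card : ℝ) * S.AmaxS Sc⌉ with hP𝔏
  have hP𝔏0 : (0 : ℤ) ≤ P𝔏 := Int.ceil_nonneg (mul_nonneg (Nat.cast_nonneg _) (le_trans zero_le_one (S.one_le_AmaxS Sc)))
  have hU : (S.unk Sc.L₀ 𝔏).card ≤ S.UcardS Sc := S.card_unk_le_UcardS Sc h𝔏
  have hPP : P𝔏 ≤ S.PmaxS Sc := by
    rw [hP𝔏]; unfold PmaxS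
    exact Int.ceil_mono (mul_le_mul_of_nonneg_right (by exact_mod_cast hU) (le_trans zero_le_one (S.one_le_AmaxS Sc)))
  -- monotone transfer of the k-step inequality
  have hKCle : ∀ (lev : ℕ) (x₁ : ℤ) (τ : Tau S.n),
      S.KC (S.unk Sc.L₀ 𝔏).card P𝔏 Sc.L₀ Sc.H Sc.Sd lev (S.Lb side lev) x₁ τ ≤
        S.KC (S.UcardS Sc) (S.PmaxS Sc) Sc.L₀ Sc.H Sc.Sd lev (S.Lb side lev) x₁ τ :=
    fun lev x₁ τ => S.KC_mono hU hP𝔏0 hPP Sc.L₀ Sc.H Sc.Sd lev (S.Lb side lev) le_rfl τ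
  have hKCpos : ∀ (lev : ℕ) (x₁ : ℤ) (τ : Tau S.n), 0 < S.KC (S.unk Sc.L₀ 𝔏).card P𝔏 Sc.L₀ Sc.H Sc.Sd lev (S.Lb side lev) x₁ τ := by
    intro lev x₁ τ
    unfold KC
    have hM : (0 : ℝ) ≤ M0C Sc.L₀ Sc.H Sc.Sd lev x₁ τ.1 := by
      have : (0 : ℤ) ≤ M0C Sc.L₀ Sc.H Sc.Sd lev x₁ τ.1 := by unfold M0C; exact Int.ceil_nonneg (by positivity)
      exact_mod_cast this
    have hX : (0 : ℝ) ≤ S.XbC (S.Lb side lev) := by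
      have : (0 : ℤ) ≤ S.XbC (S.Lb side lev) := by
        unfold XbC; exact mul_nonneg (by norm_num) (mul_nonneg (sum_nonneg fun j _ => abs_nonneg _) (sum_nonneg fun j _ => by positivity))
      exact_mod_cast this
    have hP' : (0 : ℝ) ≤ P𝔏 := by exact_mod_cast hP𝔏0
    positivity
  have htrans : ∀ (lev : ℕ) (x₁ : ℤ) (τ : Tau S.n) (a : ℝ),
      a < 1 / S.KC (S.UcardS Sc) (S.PmaxS Sc) Sc.L₀ Sc.H Sc.Sd lev (S.Lb side lev) x₁ τ →
      a < 1 / S.KC (S.unk Sc.L₀ 𝔏).card P𝔏 Sc.L₀ Sc.H Sc.Sd lev (S.Lb side lev) x₁ τ :=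
    fun lev x₁ τ a h => lt_of_lt_of_le h (one_div_le_one_div_of_le (hKCpos lev x₁ τ) (hKCle lev x₁ τ))
  -- monotone transfer of the half-step inequality
  have hHtrans : ∀ (lev : ℕ) (s₁ : ℤ) (τ : Tau S.n) (a : ℝ),
      a < (S.DC (S.Lb side lev) Sc.H s₁ τ : ℝ) / (4 * (S.DC (S.Lb side lev) Sc.H s₁ τ : ℝ) ^ 2 *
        (1 + (S.UcardS Sc : ℝ) * (S.PmaxS Sc) * S.MhC (S.Lb side lev) Sc.L₀ Sc.H Sc.Sd lev s₁ τ) * CW77.heightProd S.α ^ 3) ^ (2 ^ (S.n + 1)) →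
      a < (S.DC (S.Lb side lev) Sc.H s₁ τ : ℝ) / (4 * (S.DC (S.Lb side lev) Sc.H s₁ τ : ℝ) ^ 2 *
        (1 + ((S.unk Sc.L₀ 𝔏).card : ℝ) * P𝔏 * S.MhC (S.Lb side lev) Sc.L₀ Sc.H Sc.Sd lev s₁ τ) * CW77.heightProd S.α ^ 3) ^ (2 ^ (S.n + 1)) := by
    intro lev s₁ τ a h
    refine lt_of_lt_of_le h ?_
    have hDpos : (0 : ℝ) < S.DC (S.Lb side lev) Sc.H s₁ τ := by
      unfold DC
      exact_mod_cast Nat.mul_pos (Nat.mul_pos (pow_pos (Nat.lcmUpto_pos _) _) (pow_pos (Int.natAbs_pos.mpr S.bj₀_ne) _))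
        (MonomialDen.one_le_monDen _ S.α_ne _)
    have hHp : (0 : ℝ) < CW77.heightProd S.α := lt_of_lt_of_le zero_lt_one (by exact_mod_cast CW77.one_le_heightProd S.α)
    have hMh : (0 : ℝ) ≤ S.MhC (S.Lb side lev) Sc.L₀ Sc.H Sc.Sd lev s₁ τ := by
      unfold MhC
      have hM : (0 : ℝ) ≤ M0C Sc.L₀ Sc.H Sc.Sd (lev + 1) s₁ τ.1 := by
        have : (0 : ℤ) ≤ M0C Sc.L₀ Sc.H Sc.Sd (lev + 1) s₁ τ.1 := by unfold M0C; exact Int.ceil_nonneg (by positivity)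
        exact_mod_cast this
      have hX : (0 : ℝ) ≤ S.XbC (S.Lb side lev) := by
        have : (0 : ℤ) ≤ S.XbC (S.Lb side lev) := by
          unfold XbC; exact mul_nonneg (by norm_num) (mul_nonneg (sum_nonneg fun j _ => abs_nonneg _) (sum_nonneg fun j _ => by positivity))
        exact_mod_cast this
      positivity
    have hUP : ((S.unk Sc.L₀ 𝔏).card : ℝ) * P𝔏 ≤ (S.UcardS Sc : ℝ) * (S.PmaxS Sc) :=
      mul_le_mul (by exact_mod_cast hU) (by exact_mod_cast hPP) (by exact_mod_cast hP𝔏0) (Nat.cast_nonneg _)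
    have h1 : 0 < 4 * (S.DC (S.Lb side lev) Sc.H s₁ τ : ℝ) ^ 2 *
        (1 + ((S.unk Sc.L₀ 𝔏).card : ℝ) * P𝔏 * S.MhC (S.Lb side lev) Sc.L₀ Sc.H Sc.Sd lev s₁ τ) * CW77.heightProd S.α ^ 3 := by
      have : (0 : ℝ) ≤ ((S.unk Sc.L₀ 𝔏).card : ℝ) * P𝔏 * S.MhC (S.Lb side lev) Sc.L₀ Sc.H Sc.Sd lev s₁ τ :=
        mul_nonneg (mul_nonneg (Nat.cast_nonneg _) (by exact_mod_cast hP𝔏0)) hMh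
      positivity
    refine div_le_div_of_nonneg_left hDpos.le (pow_pos h1 _) (pow_le_pow_left₀ h1.le ?_ _)
    have : ((S.unk Sc.L₀ 𝔏).card : ℝ) * P𝔏 * S.MhC (S.Lb side lev) Sc.L₀ Sc.H Sc.Sd lev s₁ τ ≤
        (S.UcardS Sc : ℝ) * (S.PmaxS Sc) * S.MhC (S.Lb side lev) Sc.L₀ Sc.H Sc.Sd lev s₁ τ := mul_le_mul_of_nonneg_right hUP hMh
    exact mul_le_mul_of_nonneg_right (mul_le_mul_of_nonneg_left (by linarith) (by positivity)) (pow_pos hHp 3).le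
  refine ⟨?_, ?_, ?_, ?_⟩
  · -- level 0 k-steps
    intro ν hν
    exact S.kStepHypU_of_ineq hH1 Sc.L₀ Sc.Sd 0 Sc.m 𝔏 (S.Lb side 0) P𝔏 hP𝔏0 (S.one_le_tS Sc 0) (S.TordS_kstep Sc 0 ν hν)
      (fun x₁ hx₁ τ hτ => htrans 0 x₁ τ _ (hK0 ν hν x₁ hx₁ τ hτ))
  · -- half-steps
    intro lev hlev
    exact S.halfStepHypU_of_ineq hH1 hlev Sc.L₀ Sc.m 𝔏 (S.Lb side lev) P𝔏 (S.one_le_tS Sc lev) (S.TordS_half Sc lev (by omega))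
      (fun s₁ hs₁ hs₁' τ hτ => hHtrans lev s₁ τ _ (hH lev hlev s₁ hs₁ hs₁' τ hτ))
  · -- odd-node k-steps
    intro lev hlev
    exact S.kStepOddHypU_of_ineq hH1 Sc.L₀ Sc.Sd (lev + 1) Sc.m 𝔏 (S.Lb side (lev + 1)) P𝔏 hP𝔏0 (S.one_le_tS Sc (lev + 1))
      (S.TordS_kstep Sc (lev + 1) 0 (by omega)) (fun x₁ hx₁ τ hτ => htrans (lev + 1) x₁ τ _ (hO lev hlev x₁ hx₁ τ hτ))
  · -- symmetric k-steps of the levels ≥ 1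
    intro lev hlev ν hν1 hνn
    exact S.kStepHypU_of_ineq hH1 Sc.L₀ Sc.Sd (lev + 1) Sc.m 𝔏 (S.Lb side (lev + 1)) P𝔏 hP𝔏0 (S.one_le_tS Sc (lev + 1))
      (S.TordS_kstep Sc (lev + 1) ν hνn) (fun x₁ hx₁ τ hτ => htrans (lev + 1) x₁ τ _ (hK lev hlev ν hν1 hνn x₁ hx₁ τ hτ))

end G3Setup

end Summit.ABC.StewartYu

end
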